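import Literature.Algebra.Lie.Sl2CasimirCommute
import HarnessLib

/-!
# An `sl₂`-triple of operators with Casimir `3` acts through copies of the standard representation

Topic `Literature/Algebra/Lie` (namespace `Literature.Algebra.Lie.Sl2`, continuing `Sl2Strings`: the triple `(H, E, F)`
of endomorphisms of a vector space `V` and the Casimir operator
`casimir H E F = 4 F E + H² + 2 H`, which acts by `m (m + 2)` on a primitive vector of weight `m`). Theorems only (no
definition, no named fact, D-0026). Written for the cell `pub-hodgecm2` (COR-CM), seat `b27`, count-neutral own lane
MT-RANK-SEVEN-TYPEIII (the type-III position of the rung `dim MT(H¹X) = 7`): there the compact factor `𝔨 ≅ 𝔰𝔩₂(ℂ)` of the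
complexified Hodge Lie algebra is shown to have Casimir `3` on `H¹(X, ℂ)`, and this file converts that single scalar
identity into the operator identities of a direct sum of standard representations.

PRINTED RESULT (the classification of finite-dimensional `𝔰𝔩₂`-modules, read backwards from the Casimir). J. E. Humphreys,
GTM 9, §7.2 (Thm. and Cor.: the simple module `V(m)` has weights `m, m − 2, …, −m`, and on it the Casimir acts by a scalar
determined by `m`); J.-P. Serre, *Complex Semisimple Lie Algebras*, IV Thm. 2–3; Bourbaki LIE VIII §1. Since
`m ↦ m (m + 2)` is injective on `ℕ`, a finite-dimensional module on which `4 F E + H² + 2 H = 3 = 1 · (1 + 2)` is a sum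
of copies of `V(1) = std`, i.e. `H² = 1`, `E² = F² = 0`, `E F` and `F E` are the two weight projectors.

THIS FILE proves the operator identities DIRECTLY, WITHOUT complete reducibility and WITHOUT assuming `H` diagonalisable
(diagonalisability is a conclusion), over an algebraically closed field `k` of characteristic `0`, for a finite-dimensional
`V`, a triple `(H, E, F)` in `End V` with the `sl₂`-relations `H E = E H + 2E`, `H F = F H − 2F`, `E F = F E + H` (explicit
identities, no Lie-ring instance on `End V`) and the hypothesis `casimir H E F = 3 • 1`:

* (companion file `Sl2CasimirCommute`, §0–§1 there) the Casimir commutes with the triple as an identity in `End V`; if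
  `H A = A H + c A` then `A` maps the generalised `μ`-eigenspace `V^(μ)` of `H` into `V^(μ + c)`; chains
  `V^(μ), V^(μ + 2), …` of non-zero generalised eigenspaces terminate (used with steps `2` and `−2`).
* §2 under `casimir H E F = 3 • 1`: `4 F E = −(H + 3)(H − 1)` and `4 E F = −(H − 3)(H + 1)`; at the TOP of a chain
  (`V^(μ) ≠ 0`, `V^(μ+2) = 0`) `μ ∈ {1, −3}`, at the BOTTOM `μ ∈ {−1, 3}`; hence (**`eq_one_or_eq_neg_one_of_ne_bot`**)
  the only generalised eigenvalues of `H` are `1` and `−1`, `H = ±1` on `V^(±1)` and `V = V^(1) ⊕ V^(−1)`.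
* §3 (**`weightOne_of_casimir_eq_three`**) `H² = 1`, `E² = 0`, `F² = 0`, `E F = ½ (1 + H)`, `F E = ½ (1 − H)`,
  `H E = E = −E H`, `H F = −F = −F H` — `V ≅ std ⊗ W` with `E`, `F`, `H` the matrix units `e₁₂ ⊗ 1`, `e₂₁ ⊗ 1`,
  `(e₁₁ − e₂₂) ⊗ 1`.

## Mathlib / tree search

Mathlib: `IsSl2Triple`, `Module.End.maxGenEigenspace`, `Module.End.iSup_maxGenEigenspace_eq_top` (algebraically closed
field), `Module.End.independent_maxGenEigenspace`, `Module.End.finite_hasEigenvalue`; no Casimir, no classification of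
`sl₂`-modules. Tree: `Sl2Strings` (string bases under a diagonalisable `H`), `Sl2WeightOne` (Casimir `−1`); neither
treats a prescribed Casimir scalar without the diagonalisability hypothesis.

## References

* [Humphreys1972] J. E. Humphreys, *Introduction to Lie Algebras and Representation Theory*, GTM 9 (1972), §7.2.
* [Bourbaki2008LieGroups79] N. Bourbaki, *Lie Groups and Lie Algebras, Ch. 7–9*, VIII §1 no. 2–3.
* [FultonHarris1991] W. Fulton, J. Harris, *Representation Theory*, GTM 129 (1991), Lecture 11 (§11.1).
-/

noncomputable section

namespace Literature.Algebra.Lie.Sl2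

open Module

variable {k : Type*} [Field k]
variable {V : Type*} [AddCommGroup V] [Module k V]
variable {H E F : Module.End k V}

/-! ## §2 Casimir `3`: the generalised eigenvalues of `H` are `±1` -/

/-- `(H − a)(H − b) = H² − (a + b) H + a b`. [folklore] -/
private theorem sub_smul_one_mul_sub_smul_one (a b : k) :
    (H - a • (1 : Module.End k V)) * (H - b • (1 : Module.End k V)) = H * H - (a + b) • H + (a * b) • 1 := by
  simp only [sub_mul, mul_sub, smul_mul_assoc, mul_smul_comm, one_mul, mul_one]
  module

section CasimirThree

/-- `4 F E = 3 − H² − 2H = −(H + 3)(H − 1)` when the Casimir is `3`. [cite: Humphreys1972, §7.2] -/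
theorem four_smul_F_mul_E_eq (hC : casimir H E F = (3 : k) • (1 : Module.End k V)) :
    (4 : k) • (F * E) = -((H - (-3 : k) • (1 : Module.End k V)) * (H - (1 : k) • (1 : Module.End k V))) := by
  have h : (4 : k) • (F * E) = (3 : k) • (1 : Module.End k V) - H * H - (2 : k) • H := by
    rw [← hC, casimir]
    abel
  rw [h, sub_smul_one_mul_sub_smul_one]
  module

/-- `4 E F = 3 − H² + 2H = −(H − 3)(H + 1)` when the Casimir is `3`. [cite: Humphreys1972, §7.2] -/
theorem four_smul_E_mul_F_eq (hEF : E * F = F * E + H) (hC : casimir H E F = (3 : k) • (1 : Module.End k V)) :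
    (4 : k) • (E * F) = -((H - (3 : k) • (1 : Module.End k V)) * (H - (-1 : k) • (1 : Module.End k V))) := by
  have h : (4 : k) • (E * F) = (3 : k) • (1 : Module.End k V) - H * H + (2 : k) • H := by
    rw [hEF, smul_add, ← hC, casimir]
    module
  rw [h, sub_smul_one_mul_sub_smul_one]
  module

/-- **Top of a chain**: if `V^(μ) ∋ v` and `V^(μ + 2) = 0` then `(H + 3)(H − 1) v = 0` (`E v = 0`, so `4 F E v = 0`).
[cite: Humphreys1972, §7.2] -/
theorem sub_sub_apply_eq_zero_of_top (hHE : H * E = E * H + (2 : k) • E)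
    (hC : casimir H E F = (3 : k) • (1 : Module.End k V)) {μ : k} (htop : H.maxGenEigenspace (μ + 2) = ⊥) {v : V}
    (hv : v ∈ H.maxGenEigenspace μ) :
    (H - (-3 : k) • (1 : Module.End k V)) ((H - (1 : k) • (1 : Module.End k V)) v) = 0 := by
  have hEv : E v = 0 := by
    have h := apply_E_mem_maxGenEigenspace hHE hv
    rw [htop] at h
    exact (Submodule.mem_bot k).1 h
  have h4 := LinearMap.congr_fun (four_smul_F_mul_E_eq hC) v
  rw [LinearMap.smul_apply, Module.End.mul_apply, hEv, map_zero, smul_zero, LinearMap.neg_apply, eq_comm,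
    neg_eq_zero, Module.End.mul_apply] at h4
  exact h4

/-- **Bottom of a chain**: if `V^(μ) ∋ v` and `V^(μ − 2) = 0` then `(H − 3)(H + 1) v = 0` (`F v = 0`, so `4 E F v = 0`).
[cite: Humphreys1972, §7.2] -/
theorem sub_sub_apply_eq_zero_of_bot (hHF : H * F = F * H - (2 : k) • F) (hEF : E * F = F * E + H)
    (hC : casimir H E F = (3 : k) • (1 : Module.End k V)) {μ : k} (hbot : H.maxGenEigenspace (μ + (-2)) = ⊥) {v : V}
    (hv : v ∈ H.maxGenEigenspace μ) :
    (H - (3 : k) • (1 : Module.End k V)) ((H - (-1 : k) • (1 : Module.End k V)) v) = 0 := by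
  have hFv : F v = 0 := by
    have h := apply_F_mem_maxGenEigenspace hHF hv
    rw [hbot] at h
    exact (Submodule.mem_bot k).1 h
  have h4 := LinearMap.congr_fun (four_smul_E_mul_F_eq hEF hC) v
  rw [LinearMap.smul_apply, Module.End.mul_apply, hFv, map_zero, smul_zero, LinearMap.neg_apply, eq_comm,
    neg_eq_zero, Module.End.mul_apply] at h4
  exact h4

/-- At the top of a chain the generalised weight is `1` or `−3`. [cite: Humphreys1972, §7.2] -/
theorem eq_of_top (hHE : H * E = E * H + (2 : k) • E) (hC : casimir H E F = (3 : k) • (1 : Module.End k V)) {μ : k}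
    (hne : H.maxGenEigenspace μ ≠ ⊥) (htop : H.maxGenEigenspace (μ + 2) = ⊥) :
    μ = 1 ∨ μ = -3 := by
  by_contra hμ
  push Not at hμ
  apply hne
  rw [Submodule.eq_bot_iff]
  intro v hv
  exact eq_zero_of_sub_sub_apply_eq_zero hμ.2 hμ.1 hv (sub_sub_apply_eq_zero_of_top hHE hC htop hv)

/-- At the bottom of a chain the generalised weight is `−1` or `3`. [cite: Humphreys1972, §7.2] -/
theorem eq_of_bot (hHF : H * F = F * H - (2 : k) • F) (hEF : E * F = F * E + H)
    (hC : casimir H E F = (3 : k) • (1 : Module.End k V)) {μ : k} (hne : H.maxGenEigenspace μ ≠ ⊥)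
    (hbot : H.maxGenEigenspace (μ + (-2)) = ⊥) :
    μ = -1 ∨ μ = 3 := by
  by_contra hμ
  push Not at hμ
  apply hne
  rw [Submodule.eq_bot_iff]
  intro v hv
  exact eq_zero_of_sub_sub_apply_eq_zero hμ.2 hμ.1 hv (sub_sub_apply_eq_zero_of_bot hHF hEF hC hbot hv)

variable [CharZero k] [FiniteDimensional k V]

/-- **The generalised eigenvalues of `H` are `1` and `−1`** when the Casimir is `3`: climbing from `V^(μ) ≠ 0` by `E`
reaches a top `μ + 2j ∈ {1, −3}`, descending by `F` a bottom `μ − 2l ∈ {−1, 3}`, and the only consistent values are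
`μ = ±1`. [cite: Humphreys1972, §7.2] [cite: Bourbaki2008LieGroups79, VIII §1 no. 2–3] -/
theorem eq_one_or_eq_neg_one_of_ne_bot (hHE : H * E = E * H + (2 : k) • E) (hHF : H * F = F * H - (2 : k) • F)
    (hEF : E * F = F * E + H) (hC : casimir H E F = (3 : k) • (1 : Module.End k V))
    {μ : k} (hne : H.maxGenEigenspace μ ≠ ⊥) : μ = 1 ∨ μ = -1 := by
  obtain ⟨j, hj, hj'⟩ := exists_top_of_ne_bot (c := (2 : k)) two_ne_zero hne
  obtain ⟨l, hl, hl'⟩ := exists_top_of_ne_bot (c := (-2 : k)) (by norm_num) hne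
  have htop := eq_of_top hHE hC hj hj'
  have hbot := eq_of_bot hHF hEF hC hl hl'
  -- four linear cases over `ℕ`-casts in characteristic `0`
  have hcast : ∀ n : ℕ, ((n : k) + 1 ≠ 0) := fun n => by exact_mod_cast Nat.succ_ne_zero n
  rcases htop with h1 | h1 <;> rcases hbot with h2 | h2
  · -- `μ + 2j = 1`, `μ − 2l = −1`: `j + l = 1`
    have hsum : ((j + l : ℕ) : k) = 1 := by
      have h : (2 : k) * ((j : k) + l) = 2 * 1 := by linear_combination h1 - h2
      exact_mod_cast mul_left_cancel₀ (two_ne_zero' k) h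
    have hjl : j + l = 1 := by exact_mod_cast hsum
    rcases Nat.eq_zero_or_pos j with hj0 | hj0
    · subst hj0
      left
      simpa using h1
    · have hl0 : l = 0 := by omega
      subst hl0
      right
      simpa using h2
  · exfalso
    have h : (2 : k) * ((j : k) + l + 1) = 0 := by linear_combination h1 - h2
    exact hcast (j + l) (by exact_mod_cast (mul_eq_zero.1 h).resolve_left (two_ne_zero' k))
  · exfalso
    have h : (2 : k) * ((j : k) + l + 1) = 0 := by linear_combination h1 - h2
    exact hcast (j + l) (by exact_mod_cast (mul_eq_zero.1 h).resolve_left (two_ne_zero' k))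
  · exfalso
    have h : (2 : k) * ((j : k) + l + 3) = 0 := by linear_combination h1 - h2
    have h' : ((j + l + 2 : ℕ) : k) + 1 = 0 := by
      push_cast
      linear_combination (mul_eq_zero.1 h).resolve_left (two_ne_zero' k)
    exact hcast (j + l + 2) h'

/-- `V^(μ) = 0` unless `μ = ±1`. [cite: Humphreys1972, §7.2] -/
theorem maxGenEigenspace_eq_bot (hHE : H * E = E * H + (2 : k) • E) (hHF : H * F = F * H - (2 : k) • F)
    (hEF : E * F = F * E + H) (hC : casimir H E F = (3 : k) • (1 : Module.End k V))
    {μ : k} (h1 : μ ≠ 1) (h2 : μ ≠ -1) : H.maxGenEigenspace μ = ⊥ := by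
  by_contra hne
  rcases eq_one_or_eq_neg_one_of_ne_bot hHE hHF hEF hC hne with h | h
  · exact h1 h
  · exact h2 h

/-- **`H = 1` on `V^(1)`** (a top: `V^(3) = 0`). [cite: Humphreys1972, §7.2] -/
theorem apply_eq_self_of_mem_one (hHE : H * E = E * H + (2 : k) • E) (hHF : H * F = F * H - (2 : k) • F)
    (hEF : E * F = F * E + H) (hC : casimir H E F = (3 : k) • (1 : Module.End k V))
    {v : V} (hv : v ∈ H.maxGenEigenspace 1) : H v = v := by
  have h3 : H.maxGenEigenspace ((1 : k) + 2) = ⊥ :=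
    maxGenEigenspace_eq_bot hHE hHF hEF hC (by norm_num) (by norm_num)
  have h := apply_eq_smul_of_sub_sub_apply_eq_zero (by norm_num) hv (sub_sub_apply_eq_zero_of_top hHE hC h3 hv)
  rwa [one_smul] at h

/-- **`H = −1` on `V^(−1)`** (a bottom: `V^(−3) = 0`). [cite: Humphreys1972, §7.2] -/
theorem apply_eq_neg_of_mem_neg_one (hHE : H * E = E * H + (2 : k) • E) (hHF : H * F = F * H - (2 : k) • F)
    (hEF : E * F = F * E + H) (hC : casimir H E F = (3 : k) • (1 : Module.End k V))
    {v : V} (hv : v ∈ H.maxGenEigenspace (-1)) : H v = -v := by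
  have h3 : H.maxGenEigenspace ((-1 : k) + (-2)) = ⊥ :=
    maxGenEigenspace_eq_bot hHE hHF hEF hC (by norm_num) (by norm_num)
  have h := apply_eq_smul_of_sub_sub_apply_eq_zero (by norm_num) hv (sub_sub_apply_eq_zero_of_bot hHF hEF hC h3 hv)
  rwa [neg_one_smul] at h

/-- **`V = V^(1) ⊔ V^(−1)`** when the Casimir is `3`. [cite: Humphreys1972, §7.2] -/
theorem maxGenEigenspace_one_sup_neg_one_eq_top (hHE : H * E = E * H + (2 : k) • E) (hHF : H * F = F * H - (2 : k) • F)
    (hEF : E * F = F * E + H) (hC : casimir H E F = (3 : k) • (1 : Module.End k V))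
    [IsAlgClosed k] :
    H.maxGenEigenspace 1 ⊔ H.maxGenEigenspace (-1) = ⊤ := by
  refine le_antisymm le_top ?_
  rw [← Module.End.iSup_maxGenEigenspace_eq_top H]
  refine iSup_le fun μ => ?_
  by_cases h1 : μ = 1
  · subst h1; exact le_sup_left
  by_cases h2 : μ = -1
  · subst h2; exact le_sup_right
  rw [maxGenEigenspace_eq_bot hHE hHF hEF hC h1 h2]
  exact bot_le

/-- Every vector splits as `v = a + b` with `H a = a`, `H b = −b`. [cite: Humphreys1972, §7.2] -/
theorem exists_add_of_casimir_eq_three (hHE : H * E = E * H + (2 : k) • E) (hHF : H * F = F * H - (2 : k) • F)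
    (hEF : E * F = F * E + H) (hC : casimir H E F = (3 : k) • (1 : Module.End k V))
    [IsAlgClosed k] (v : V) :
    ∃ a b : V, a ∈ H.maxGenEigenspace 1 ∧ b ∈ H.maxGenEigenspace (-1) ∧ v = a + b := by
  have hv : v ∈ H.maxGenEigenspace 1 ⊔ H.maxGenEigenspace (-1) := by
    rw [maxGenEigenspace_one_sup_neg_one_eq_top hHE hHF hEF hC]; exact Submodule.mem_top
  obtain ⟨a, ha, b, hb, rfl⟩ := Submodule.mem_sup.1 hv
  exact ⟨a, b, ha, hb, rfl⟩

/-! ## §3 The operator identities of `std ⊗ W` -/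

/-- **`H² = 1`.** [cite: Humphreys1972, §7.2] [cite: FultonHarris1991, §11.1] -/
theorem H_mul_H_eq_one (hHE : H * E = E * H + (2 : k) • E) (hHF : H * F = F * H - (2 : k) • F)
    (hEF : E * F = F * E + H) (hC : casimir H E F = (3 : k) • (1 : Module.End k V))
    [IsAlgClosed k] : H * H = 1 := by
  refine LinearMap.ext fun v => ?_
  obtain ⟨a, b, ha, hb, rfl⟩ := exists_add_of_casimir_eq_three hHE hHF hEF hC v
  rw [Module.End.mul_apply, Module.End.one_apply, map_add, apply_eq_self_of_mem_one hHE hHF hEF hC ha,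
    apply_eq_neg_of_mem_neg_one hHE hHF hEF hC hb, map_add, map_neg, apply_eq_self_of_mem_one hHE hHF hEF hC ha,
    apply_eq_neg_of_mem_neg_one hHE hHF hEF hC hb, neg_neg]

/-- **`E² = 0`** (`E V^(1) ⊆ V^(3) = 0`, `E V^(−1) ⊆ V^(1)`). [cite: Humphreys1972, §7.2]
[cite: FultonHarris1991, §11.1] -/
theorem E_mul_E_eq_zero (hHE : H * E = E * H + (2 : k) • E) (hHF : H * F = F * H - (2 : k) • F)
    (hEF : E * F = F * E + H) (hC : casimir H E F = (3 : k) • (1 : Module.End k V))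
    [IsAlgClosed k] : E * E = 0 := by
  have h3 : H.maxGenEigenspace ((1 : k) + 2) = ⊥ := maxGenEigenspace_eq_bot hHE hHF hEF hC (by norm_num) (by norm_num)
  have hE1 : ∀ a ∈ H.maxGenEigenspace (1 : k), E a = 0 := fun a ha => by
    have h := apply_E_mem_maxGenEigenspace hHE ha
    rw [h3] at h
    exact (Submodule.mem_bot k).1 h
  refine LinearMap.ext fun v => ?_
  obtain ⟨a, b, ha, hb, rfl⟩ := exists_add_of_casimir_eq_three hHE hHF hEF hC v
  have hEb : E b ∈ H.maxGenEigenspace (1 : k) := by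
    have h := apply_E_mem_maxGenEigenspace hHE hb
    rwa [show (-1 : k) + 2 = 1 by norm_num] at h
  rw [Module.End.mul_apply, map_add, hE1 a ha, zero_add, hE1 _ hEb, LinearMap.zero_apply]

/-- **`F² = 0`** (`F V^(−1) ⊆ V^(−3) = 0`, `F V^(1) ⊆ V^(−1)`). [cite: Humphreys1972, §7.2]
[cite: FultonHarris1991, §11.1] -/
theorem F_mul_F_eq_zero (hHE : H * E = E * H + (2 : k) • E) (hHF : H * F = F * H - (2 : k) • F)
    (hEF : E * F = F * E + H) (hC : casimir H E F = (3 : k) • (1 : Module.End k V))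
    [IsAlgClosed k] : F * F = 0 := by
  have h3 : H.maxGenEigenspace ((-1 : k) + (-2)) = ⊥ :=
    maxGenEigenspace_eq_bot hHE hHF hEF hC (by norm_num) (by norm_num)
  have hF1 : ∀ b ∈ H.maxGenEigenspace (-1 : k), F b = 0 := fun b hb => by
    have h := apply_F_mem_maxGenEigenspace hHF hb
    rw [h3] at h
    exact (Submodule.mem_bot k).1 h
  refine LinearMap.ext fun v => ?_
  obtain ⟨a, b, ha, hb, rfl⟩ := exists_add_of_casimir_eq_three hHE hHF hEF hC v
  have hFa : F a ∈ H.maxGenEigenspace (-1 : k) := by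
    have h := apply_F_mem_maxGenEigenspace hHF ha
    rwa [show (1 : k) + -2 = -1 by norm_num] at h
  rw [Module.End.mul_apply, map_add, hF1 b hb, add_zero, hF1 _ hFa, LinearMap.zero_apply]

/-- **`2 F E = 1 − H`** (`4 F E = 3 − H² − 2 H = 2 − 2H`). [cite: Humphreys1972, §7.2]
[cite: FultonHarris1991, §11.1] -/
theorem two_smul_F_mul_E_eq (hHE : H * E = E * H + (2 : k) • E) (hHF : H * F = F * H - (2 : k) • F)
    (hEF : E * F = F * E + H) (hC : casimir H E F = (3 : k) • (1 : Module.End k V))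
    [IsAlgClosed k] : (2 : k) • (F * E) = 1 - H := by
  have h : (4 : k) • (F * E) = (3 : k) • (1 : Module.End k V) - H * H - (2 : k) • H := by
    rw [← hC, casimir]
    abel
  rw [H_mul_H_eq_one hHE hHF hEF hC] at h
  have h' : (2 : k) • ((2 : k) • (F * E)) = (2 : k) • (1 - H) := by
    rw [smul_smul, show (2 : k) * 2 = 4 by norm_num, h, smul_sub, two_smul]
    module
  exact smul_right_injective (Module.End k V) (two_ne_zero' k) h'

/-- **`F E = ½ (1 − H)`.** [cite: Humphreys1972, §7.2] [cite: FultonHarris1991, §11.1] -/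
theorem F_mul_E_eq (hHE : H * E = E * H + (2 : k) • E) (hHF : H * F = F * H - (2 : k) • F)
    (hEF : E * F = F * E + H) (hC : casimir H E F = (3 : k) • (1 : Module.End k V))
    [IsAlgClosed k] : F * E = (2 : k)⁻¹ • (1 - H) := by
  rw [← two_smul_F_mul_E_eq hHE hHF hEF hC, smul_smul, inv_mul_cancel₀ (two_ne_zero' k), one_smul]

/-- **`2 E F = 1 + H`.** [cite: Humphreys1972, §7.2] [cite: FultonHarris1991, §11.1] -/
theorem two_smul_E_mul_F_eq (hHE : H * E = E * H + (2 : k) • E) (hHF : H * F = F * H - (2 : k) • F)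
    (hEF : E * F = F * E + H) (hC : casimir H E F = (3 : k) • (1 : Module.End k V))
    [IsAlgClosed k] : (2 : k) • (E * F) = 1 + H := by
  rw [hEF, smul_add, two_smul_F_mul_E_eq hHE hHF hEF hC, two_smul]
  abel

/-- **`E F = ½ (1 + H)`.** [cite: Humphreys1972, §7.2] [cite: FultonHarris1991, §11.1] -/
theorem E_mul_F_eq (hHE : H * E = E * H + (2 : k) • E) (hHF : H * F = F * H - (2 : k) • F)
    (hEF : E * F = F * E + H) (hC : casimir H E F = (3 : k) • (1 : Module.End k V))
    [IsAlgClosed k] : E * F = (2 : k)⁻¹ • (1 + H) := by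
  rw [← two_smul_E_mul_F_eq hHE hHF hEF hC, smul_smul, inv_mul_cancel₀ (two_ne_zero' k), one_smul]

/-- **`E H = −E`** (`E` kills `V^(1)` and `H = −1` on `V^(−1)`). [cite: Humphreys1972, §7.2] -/
theorem E_mul_H_eq (hHE : H * E = E * H + (2 : k) • E) (hHF : H * F = F * H - (2 : k) • F)
    (hEF : E * F = F * E + H) (hC : casimir H E F = (3 : k) • (1 : Module.End k V))
    [IsAlgClosed k] : E * H = -E := by
  have h3 : H.maxGenEigenspace ((1 : k) + 2) = ⊥ := maxGenEigenspace_eq_bot hHE hHF hEF hC (by norm_num) (by norm_num)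
  have hE1 : ∀ a ∈ H.maxGenEigenspace (1 : k), E a = 0 := fun a ha => by
    have h := apply_E_mem_maxGenEigenspace hHE ha
    rw [h3] at h
    exact (Submodule.mem_bot k).1 h
  refine LinearMap.ext fun v => ?_
  obtain ⟨a, b, ha, hb, rfl⟩ := exists_add_of_casimir_eq_three hHE hHF hEF hC v
  rw [Module.End.mul_apply, map_add, apply_eq_self_of_mem_one hHE hHF hEF hC ha,
    apply_eq_neg_of_mem_neg_one hHE hHF hEF hC hb,
    LinearMap.neg_apply, map_add, map_add, map_neg, hE1 a ha, zero_add, zero_add]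

/-- **`H E = E`.** [cite: Humphreys1972, §7.2] -/
theorem H_mul_E_eq (hHE : H * E = E * H + (2 : k) • E) (hHF : H * F = F * H - (2 : k) • F)
    (hEF : E * F = F * E + H) (hC : casimir H E F = (3 : k) • (1 : Module.End k V))
    [IsAlgClosed k] : H * E = E := by
  rw [hHE, E_mul_H_eq hHE hHF hEF hC, two_smul]
  abel

/-- **`F H = F`** (`F` kills `V^(−1)` and `H = 1` on `V^(1)`). [cite: Humphreys1972, §7.2] -/
theorem F_mul_H_eq (hHE : H * E = E * H + (2 : k) • E) (hHF : H * F = F * H - (2 : k) • F)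
    (hEF : E * F = F * E + H) (hC : casimir H E F = (3 : k) • (1 : Module.End k V))
    [IsAlgClosed k] : F * H = F := by
  have h3 : H.maxGenEigenspace ((-1 : k) + (-2)) = ⊥ :=
    maxGenEigenspace_eq_bot hHE hHF hEF hC (by norm_num) (by norm_num)
  have hF1 : ∀ b ∈ H.maxGenEigenspace (-1 : k), F b = 0 := fun b hb => by
    have h := apply_F_mem_maxGenEigenspace hHF hb
    rw [h3] at h
    exact (Submodule.mem_bot k).1 h
  refine LinearMap.ext fun v => ?_
  obtain ⟨a, b, ha, hb, rfl⟩ := exists_add_of_casimir_eq_three hHE hHF hEF hC v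
  rw [Module.End.mul_apply, map_add, apply_eq_self_of_mem_one hHE hHF hEF hC ha,
    apply_eq_neg_of_mem_neg_one hHE hHF hEF hC hb,
    map_add, map_add, map_neg, hF1 b hb, neg_zero]

/-- **`H F = −F`.** [cite: Humphreys1972, §7.2] -/
theorem H_mul_F_eq (hHE : H * E = E * H + (2 : k) • E) (hHF : H * F = F * H - (2 : k) • F)
    (hEF : E * F = F * E + H) (hC : casimir H E F = (3 : k) • (1 : Module.End k V))
    [IsAlgClosed k] : H * F = -F := by
  rw [hHF, F_mul_H_eq hHE hHF hEF hC, two_smul]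
  abel

/-- **An `sl₂`-triple of operators with Casimir `4 F E + H² + 2 H = 3` on a finite-dimensional space over an
algebraically closed field of characteristic `0` is a sum of standard representations**: `H² = 1`, `E² = 0`, `F² = 0`,
`E F = ½(1 + H)`, `F E = ½(1 − H)`, `H E = E = −E H`, `H F = −F = −F H`. [cite: Humphreys1972, §7.2]
[cite: Bourbaki2008LieGroups79, VIII §1 no. 2–3] [cite: FultonHarris1991, §11.1] -/
theorem weightOne_of_casimir_eq_three (hHE : H * E = E * H + (2 : k) • E) (hHF : H * F = F * H - (2 : k) • F)
    (hEF : E * F = F * E + H) (hC : casimir H E F = (3 : k) • (1 : Module.End k V))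
    [IsAlgClosed k] :
    H * H = 1 ∧ E * E = 0 ∧ F * F = 0 ∧ E * F = (2 : k)⁻¹ • (1 + H) ∧ F * E = (2 : k)⁻¹ • (1 - H) ∧
      H * E = E ∧ E * H = -E ∧ H * F = -F ∧ F * H = F :=
  ⟨H_mul_H_eq_one hHE hHF hEF hC, E_mul_E_eq_zero hHE hHF hEF hC, F_mul_F_eq_zero hHE hHF hEF hC,
    E_mul_F_eq hHE hHF hEF hC, F_mul_E_eq hHE hHF hEF hC, H_mul_E_eq hHE hHF hEF hC, E_mul_H_eq hHE hHF hEF hC,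
    H_mul_F_eq hHE hHF hEF hC, F_mul_H_eq hHE hHF hEF hC⟩

end CasimirThree

end Literature.Algebra.Lie.Sl2

end
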